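import Summits.Langlands.Langlands.Theses.OrdinaryPrimeTransport
import Literature.NumberTheory.Automorphic.PDAutomorphyLiftingGL2TotallyReal
import HarnessLib

/-!
# SKELETON — line `PartialWeightOneLiftingTR` for the crux `ReciprocityUpToIrreducibility`
# (item stmt-Langlands-14328; routes IrreducibilityBySelfDuality / OrdinaryPrimeTransport)
# forward generator G4 ladder-down, generation 18 (unit fwd2-ladder-Langlands-14328-g18)

Dial θ18 = THE NUMBER `s` OF SINGULAR (WEIGHT-ONE) PLACES above `p` admitted in potentially-diagonalizable
automorphy LIFTING for `GL₂` over a totally real field `F` — inside clause (B) of the top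
E = `ReciprocityUpToIrreducibility`.  Family `SingularPlaceLifting s := LiftingOn (· ≤ s)`: the binders are
VERBATIM those of the landed named fact `Literature.NumberTheory.Automorphic.BLGGT2014_thm421_GL2_totallyReal`
(Barnet-Lamb–Gee–Geraghty–Taylor, Ann. of Math. 179 (2014), Thm. 4.2.1 for `n = 2`, as used in Dieulefait–Pacetti
arXiv:2209.09178 Thm. 8.11: `F` totally real, `p ≥ 7` unramified in `F`, `ρ` irreducible, a.e. unramified, totally
odd, potentially diagonalizable at every `v ∣ p`, `ρ̄|Γ_{F(ζ_p)}` absolutely irreducible, residually PD-automorphic of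
level prime to `p`) EXCEPT that the local condition "crystalline with DISTINCT labelled Hodge–Tate weights at every
`v ∣ p`" is DIALLED: it is asked only OFF a finite set `Z` of places above `p` with `#Z ≤ s` (and some place above `p`
outside `Z`), while AT `v ∈ Z` the representation is SINGULAR — de Rham of labelled Hodge–Tate weights `{0,0}`,
unramified at `v`, residually `p`-distinguished (the Buzzard–Taylor / Kassaei / Pilloni–Stroh weight-one hypotheses,
asked at ONE place).  `s = 0` is the FLOOR (`floor_zero : BLGGT2014_thm421_GL2_totallyReal → SingularPlaceLifting 0`,
PROVED, file `Lines/PartialWeightOneLiftingTR_special.lean`); `s = 1` is THE RUNG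
`PartialWeightOneLiftingTR := SingularPlaceLifting 1` = automorphy lifting towards Hilbert modular forms of PARTIAL
WEIGHT ONE (weight `1` exactly at the singular place, regular elsewhere).  `#Z ≤ 1 ⇔ #Z = 0 ∨ #Z = 1` gives
`rung_of_cells : SingularPlaceLifting 0 → OneSingularPlaceCell → PartialWeightOneLiftingTR` (PROVED), so the rung is
DERIVED from the floor fact and ONE open stub, the single-singular-place cell:

  F totally real, p ≥ 7 unramified in F, ρ : Γ_F → GL₂(ℚ̄_p) irreducible, a.e. unramified, totally odd, (TW),
  residually PD-automorphic, potentially diagonalizable above p, crystalline HT-regular at every v ∣ p but ONE place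
  v₁, where ρ is unramified with distinct Frobenius eigenvalues mod 𝔪  ⇒  automorphic (a.e. Satake = Frobenius).

It follows from `Langlands` (on-path lemma `PartialWeightOneLiftingTR_of_Langlands`, file
`Lines/PartialWeightOneLiftingTR_onpath.lean`).  Located stop of the floor's method (every rung a theorem, the
ceiling a theorem-shaped gap): every proved automorphy-lifting / classicality theorem for `GL₂` over a totally real
`F ≠ ℚ` has ALL places above `p` regular (Taylor–Wiles–Kisin / BLGGT, small-slope classicality) or ALL places
singular (parallel weight one: Kassaei 2013, Kassaei–Sasaki–Tian 2014, Pilloni–Stroh 2016, Sasaki 2019); the MIXED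
signature is open in characteristic zero — Stubley (Math. Ann. 2023, §7.3): "as yet no results have appeared for
forms of partial weight one", the expected attack being Buzzard–Taylor/Kassaei gluing "prime by prime" at split `p`;
Gee–Kassaei (2013) leave partial weight one open; Grossi's higher Hida theory for Hilbert modular varieties
(arXiv:2106.05666, main theorem) controls weights `k_𝔭 ≤ -1` or `k_𝔭 ≥ 3` only; Hsu / Barrera–Gräf–Williams-type
partial classicality needs slope `< k_𝔭 - 1`, vacuous at `k_𝔭 = 1`; the 2024–2026 results on partial weight one
(Diamond–Sasaki, De Maria, Wiersema arXiv:2603.02014) are MOD `p` (geometric Serre weights), not liftings.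

Four registered stubs; kernel-checked composition `ReciprocityUpToIrreducibility_of : <stub₁-sig> → … → <stub₄-sig> → E`
(the rung enters through the PROVED `rung_of_cells`) and `ReciprocityUpToIrreducibility_proof`:

* `stub_floorFact : BLGGT2014_thm421_GL2_totallyReal` — the floor, a theorem IN PRINT held as a named fact;
* `stub_singularCell : OneSingularPlaceCell` — **THE OPEN CORE = BC9's cap-lifting input** (partial weight one
  automorphy lifting at exactly one singular place);
* `stub_sectorMerge : PartialWeightOneLiftingTR → SectorGaloisToAutomorphic` — from a.e.-Satake automorphy on the
  sector to clause (B) of E VERBATIM (`Corresponds Rec ι π ρ`: cuspidality is given, local–global compatibility at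
  every finite place for every `Rec` is the honest debt, cf. `Disproof.lean` §B/§C);
* `stub_offSector : OffSectorReciprocity` — E off the sector (clause (A′) entire; clause (B) for `n ≠ 2` and for
  `n = 2` off `InSingularSector`), the honest complement.

TREE COPY: concludes route OrdinaryPrimeTransport's decl
`Summit.Langlands.Langlands.Theses.OrdinaryPrimeTransport.ReciprocityUpToIrreducibility` (the shared item stmt-Langlands-14328;
the IrreducibilityBySelfDuality decl is the same text verbatim, `Iff.rfl` — as for g3–g17 the IrreducibilityBySelfDuality Theses
module does not elaborate on the crux-write host (`remote:incoherent … mismatch`); the seat-folder copy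
`line-PartialWeightOneLiftingTR.lean` (identical up to that name and import) concludes
`Summit.Langlands.Langlands.Theses.IrreducibilityBySelfDuality.ReciprocityUpToIrreducibility` BY NAME, rc 0, sorries 4 = stubs).
-/

noncomputable section

set_option linter.dupNamespace false

open scoped MatrixGroups Matrix NumberField Classical
open NumberField IsDedekindDomain Field Filter
open Literature.NumberTheory.Automorphic Literature.NumberTheory.GaloisRepresentations
open Literature.NumberTheory.PAdicHodge
open Summit.Langlands

namespace Summit.Langlands.Langlands.Cruxes.ReciprocityUpToIrreducibility.PartialWeightOneLiftingTR


/-! ## 1. The local clauses at `v ∣ p` -/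

/-- **Regular clause at `v`** (VERBATIM the local clause of `BLGGT2014_thm421_GL2_totallyReal` at one place):
`ρ|Γ_{F_v}` is CRYSTALLINE for the PINNED Fontaine datum with two DISTINCT `τ`-labelled Hodge–Tate weights for
every `ℚ_p`-label `τ` — the place `v` is REGULAR (classical weight `k_v ≥ 2`). -/
def RegularCrystallineAt {F : Type} [Field F] [NumberField F] (p : ℕ) [Fact p.Prime]
    (ρ : FramedGaloisRep F (PadicAlgCl p) 2) (v : HeightOneSpectrum (𝓞 F))
    (hv : ((p : ℕ) : 𝓞 F) ∈ v.asIdeal) : Prop :=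
  let D := fontainePstAdicCompletion v p hv
  D.IsCrystallineFramed (ρ.toLocal v) ∧
  (letI := D.algebra
   ∀ τ : v.adicCompletion F →ₐ[ℚ_[p]] PadicAlgCl p,
    let M := ρ.labelledHodgeTateWeightsAt v D.algebra D.𝔅 τ.toRingHom
    M.Nodup ∧ Multiset.card M = 2)

/-- **Singular (weight-one) clause at `v`** — the NEW cell of the dial: `ρ|Γ_{F_v}` is de Rham for the pinned
Fontaine datum with `τ`-labelled Hodge–Tate weights `{0,0}` for every label (the ARTIN / WEIGHT-ONE signature,
the per-place conjunct of `IsDeRhamWeightZeroGL2`), UNRAMIFIED at `v`, and residually `p`-DISTINGUISHED at `v`: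
an arithmetic Frobenius at `v` has characteristic polynomial `(X - α)(X - β)` with `α ≢ β (mod 𝔪)` — the
hypotheses of Buzzard–Taylor / Kassaei / Pilloni–Stroh weight-one lifting, asked at ONE place.
[cite: BuzzardTaylor1999, Thm. 1] [cite: Pan2022LocallyAnalytic, Thm. 1.0.5] -/
def SingularUnramifiedAt {F : Type} [Field F] [NumberField F] (p : ℕ) [Fact p.Prime]
    (ρ : FramedGaloisRep F (PadicAlgCl p) 2) (v : HeightOneSpectrum (𝓞 F))
    (hv : ((p : ℕ) : 𝓞 F) ∈ v.asIdeal) : Prop :=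
  let D := fontainePstAdicCompletion v p hv
  D.IsDeRhamFramed (ρ.toLocal v) ∧
  (letI := D.algebra
   ∀ τ : v.adicCompletion F →ₐ[ℚ_[p]] PadicAlgCl p,
    ρ.labelledHodgeTateWeightsAt v D.algebra D.𝔅 τ.toRingHom = {0, 0}) ∧
  ρ.IsUnramifiedAt v ∧
  ∃ α β : PadicAlgCl p,
    ρ.HasFrobCharpolyAt v ((Polynomial.X - Polynomial.C α) * (Polynomial.X - Polynomial.C β)) ∧
    ¬ ‖α - β‖ < 1

/-- `ρ|Γ_{F_v}` is POTENTIALLY DIAGONALIZABLE at every `v ∣ p` (the floor fact's clause, verbatim). -/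
def PotentiallyDiagonalizableAt {F : Type} [Field F] [NumberField F] (p : ℕ) [Fact p.Prime]
    (ρ : FramedGaloisRep F (PadicAlgCl p) 2) : Prop :=
  ∀ (v : HeightOneSpectrum (𝓞 F)) (hv : ((p : ℕ) : 𝓞 F) ∈ v.asIdeal),
    Nonempty (PstCrystallineExtensionData (fontainePstAdicCompletion v p hv)) ∧
    ∀ 𝔈 : PstCrystallineExtensionData (fontainePstAdicCompletion v p hv),
      letI := (fontainePstAdicCompletion v p hv).algebra
      IsPotentiallyDiagonalizable 𝔈.𝔅 (ρ.toLocal v)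

/-- **The Taylor–Wiles hypothesis**: `ρ̄|Γ_{F(ζ_p)}` absolutely irreducible (trace rendering; the fact's clause). -/
def TaylorWilesHypothesis (F : Type) [Field F] [NumberField F] (p : ℕ) [Fact p.Prime]
    (ρ : FramedGaloisRep F (PadicAlgCl p) 2) : Prop :=
  ¬ ∃ χ₁ χ₂ : absoluteGaloisGroup (CyclotomicField p F) →* (PadicAlgCl p)ˣ,
      IsOpen (χ₁.ker : Set (absoluteGaloisGroup (CyclotomicField p F))) ∧
      IsOpen (χ₂.ker : Set (absoluteGaloisGroup (CyclotomicField p F))) ∧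
      ∀ σ, ‖(ρ.restrictField (CyclotomicField p F) σ).val.trace -
        ((χ₁ σ : PadicAlgCl p) + (χ₂ σ : PadicAlgCl p))‖ < 1

/-- **Residually PD-automorphic of level prime to `p`** (the fact's witness clause verbatim): a cuspidal `π₀`,
`L`-algebraic with a REGULAR infinity type, unramified above `p`, attached a.e. to some `ρ₀ ≡ ρ (mod 𝔪)` that is
potentially diagonalizable above `p`. -/
def ResiduallyPDAutomorphic (F : Type) [Field F] [NumberField F] (p : ℕ) [Fact p.Prime]
    (hcpt : isCompact_glFiniteIntegralLevel 2 F) (ι : PadicAlgCl p ≃+* ℂ)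
    (ρ : FramedGaloisRep F (PadicAlgCl p) 2) : Prop :=
  ∃ (π₀ : CuspidalAutomorphicRepData 2 F hcpt) (ρ₀ : FramedGaloisRep F (PadicAlgCl p) 2),
    π₀.1.IsLAlgebraic ∧ (∃ T : InfinityType F 2, π₀.1.HasInfinityType T ∧ T.IsRegular) ∧
    SatakeFrobCompatibleAE ι π₀.1 ρ₀ ∧ (∀ σ, ‖(ρ σ).val.trace - (ρ₀ σ).val.trace‖ < 1) ∧
    (∀ v : HeightOneSpectrum (𝓞 F), ((p : ℕ) : 𝓞 F) ∈ v.asIdeal → π₀.1.IsUnramifiedAt v) ∧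
    ∀ (v : HeightOneSpectrum (𝓞 F)) (hv : ((p : ℕ) : 𝓞 F) ∈ v.asIdeal)
      (𝔈 : PstCrystallineExtensionData (fontainePstAdicCompletion v p hv)),
      letI := (fontainePstAdicCompletion v p hv).algebra
      IsPotentiallyDiagonalizable 𝔈.𝔅 (ρ₀.toLocal v)

/-! ## 2. The family, graded by a condition on the NUMBER of singular places -/

/-- **Lifting with singular signature constrained by `P`.**  For `F` totally real, `p ≥ 7` unramified in `F`,
`ρ : Γ_F → GL₂(ℚ̄_p)` irreducible, a.e. unramified, totally odd, and a finite set `Z` of places ABOVE `p` with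
`P (#Z)`, some place above `p` outside `Z`: REGULAR crystalline (distinct labelled Hodge–Tate weights) at every
`v ∣ p` off `Z`, SINGULAR (de Rham of weights `{0,0}`, unramified, residually `p`-distinguished) at every
`v ∈ Z`, potentially diagonalizable above `p`, Taylor–Wiles hypothesis, residually PD-automorphic ⇒ `ρ` is
automorphic: an `L`-algebraic cuspidal `π` of `GL₂(𝔸_F)` with a.e. Satake–Frobenius compatibility.  The expected
`π` has PARTIAL WEIGHT ONE: weight `1` exactly at (the infinite places paired by `p`-adic labels with) `Z`. -/
def LiftingOn (P : ℕ → Prop) : Prop :=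
  ∀ (F : Type) [Field F] [NumberField F], IsTotallyReal F → ∀ (p : ℕ) [Fact p.Prime], 7 ≤ p →
    ¬ ((p : ℤ) ∣ NumberField.discr F) →
    ∀ (hcpt : isCompact_glFiniteIntegralLevel 2 F) (ι : PadicAlgCl p ≃+* ℂ)
      (ρ : FramedGaloisRep F (PadicAlgCl p) 2) (Z : Finset (HeightOneSpectrum (𝓞 F))),
      P Z.card →
      (∀ v ∈ Z, ((p : ℕ) : 𝓞 F) ∈ v.asIdeal) →
      (∃ w : HeightOneSpectrum (𝓞 F), ((p : ℕ) : 𝓞 F) ∈ w.asIdeal ∧ w ∉ Z) →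
      ρ.toGaloisRep.IsIrreducible →
      (∀ᶠ v : HeightOneSpectrum (𝓞 F) in cofinite, ρ.IsUnramifiedAt v) →
      ρ.IsOdd →
      (∀ (v : HeightOneSpectrum (𝓞 F)) (hv : ((p : ℕ) : 𝓞 F) ∈ v.asIdeal), v ∉ Z →
        RegularCrystallineAt p ρ v hv) →
      (∀ (v : HeightOneSpectrum (𝓞 F)) (hv : ((p : ℕ) : 𝓞 F) ∈ v.asIdeal), v ∈ Z →
        SingularUnramifiedAt p ρ v hv) →
      PotentiallyDiagonalizableAt p ρ →
      TaylorWilesHypothesis F p ρ →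
      ResiduallyPDAutomorphic F p hcpt ι ρ →
      ∃ π : CuspidalAutomorphicRepData 2 F hcpt, π.1.IsLAlgebraic ∧ SatakeFrobCompatibleAE ι π.1 ρ

/-- **The rung family** `E(s)`: at most `s` singular (weight-one) places above `p`.  `E(0)` = the floor
(BLGGT Thm 4.2.1 / Dieulefait–Pacetti Thm 8.11, every place regular); `E(1)` = THE RUNG (one singular place:
PARTIAL WEIGHT ONE lifting, OPEN); `S` sits above every `E(s)`.
[cite: BarnetlambEtAl2014, Thm. 4.2.1] [cite: Stubley2023, §7.3] [cite: GeeKassaei2013, §1] -/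
def SingularPlaceLifting (s : ℕ) : Prop := LiftingOn (· ≤ s)

/-- The floor cell `E(0)`. -/
def RegularEverywhereLifting : Prop := SingularPlaceLifting 0

/-- **The open core**: EXACTLY ONE singular place (and at least one regular place) — partial weight one
automorphy lifting for `GL₂` over totally real fields. -/
def OneSingularPlaceCell : Prop := LiftingOn (· = 1)

/-- **THE RUNG**: at most one singular place. -/
def PartialWeightOneLiftingTR : Prop := SingularPlaceLifting 1

/-! ## 3. Monotonicity, cells, floor -/

/-- Weakening the cardinality condition strengthens the statement. -/
theorem liftingOn_mono {P Q : ℕ → Prop} (hPQ : ∀ m, Q m → P m) (h : LiftingOn P) : LiftingOn Q := by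
  intro F _ _ hF p _ hp hdisc hcpt ι ρ Z hcard hZp hw hirr hunr hodd hreg hsing hpd htw hmod
  exact h F hF p hp hdisc hcpt ι ρ Z (hPQ _ hcard) hZp hw hirr hunr hodd hreg hsing hpd htw hmod

/-- The dial is monotone: more singular places allowed ⇒ stronger statement. -/
theorem mono {s s' : ℕ} (hle : s ≤ s') (h : SingularPlaceLifting s') : SingularPlaceLifting s :=
  liftingOn_mono (fun _ hm => le_trans hm hle) h

/-- The rung implies the floor cell (F3 instantiation direction). -/
@[aesop safe apply]
theorem zeroCell_of_rung (h : PartialWeightOneLiftingTR) : SingularPlaceLifting 0 := mono (by norm_num) h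

/-- The rung implies the open core. -/
theorem oneCell_of_rung (h : PartialWeightOneLiftingTR) : OneSingularPlaceCell :=
  liftingOn_mono (fun _ hm => le_of_eq hm) h

/-- **The rung from its two cells** (PROVED): `#Z ≤ 1 ⇔ #Z = 0 ∨ #Z = 1`. -/
theorem rung_of_cells (h0 : SingularPlaceLifting 0) (h1 : OneSingularPlaceCell) :
    PartialWeightOneLiftingTR := by
  intro F _ _ hF p _ hp hdisc hcpt ι ρ Z hcard hZp hw hirr hunr hodd hreg hsing hpd htw hmod
  rcases Nat.le_one_iff_eq_zero_or_eq_one.mp hcard with hc | hc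
  · exact h0 F hF p hp hdisc hcpt ι ρ Z (le_of_eq hc) hZp hw hirr hunr hodd hreg hsing hpd htw hmod
  · exact h1 F hF p hp hdisc hcpt ι ρ Z hc hZp hw hirr hunr hodd hreg hsing hpd htw hmod

/-- The rung is the conjunction of its cells. -/
theorem rung_iff_cells : PartialWeightOneLiftingTR ↔ SingularPlaceLifting 0 ∧ OneSingularPlaceCell :=
  ⟨fun h => ⟨zeroCell_of_rung h, oneCell_of_rung h⟩, fun h => rung_of_cells h.1 h.2⟩

/-- **FLOOR THEOREM** (F3): BLGGT Thm 4.2.1 (the landed named fact) gives the cell `E(0)`: with no singular place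
every `v ∣ p` is regular crystalline, which is the fact's local clause verbatim; projection forgets the regular
infinity type of `π`.  No `sorry`. -/
theorem floor_zero (h : BLGGT2014_thm421_GL2_totallyReal) : SingularPlaceLifting 0 := by
  intro F _ _ hF p _ hp hdisc hcpt ι ρ Z hcard hZp _hw hirr hunr hodd hreg _hsing hpd htw hmod
  have hZ : Z = ∅ := Finset.card_eq_zero.mp (Nat.le_zero.mp hcard)
  have hcrys : ∀ (v : HeightOneSpectrum (𝓞 F)) (hv : ((p : ℕ) : 𝓞 F) ∈ v.asIdeal),
      RegularCrystallineAt p ρ v hv := fun v hv => hreg v hv (by simp [hZ])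
  obtain ⟨π, hL, -, hS⟩ := h F hF p hp hdisc hcpt ι ρ hirr hunr hodd hcrys hpd htw hmod
  exact ⟨π, hL, hS⟩

/-- F3 instantiation check: the floor IS the family at the dial value `s := 0`. -/
example (h : BLGGT2014_thm421_GL2_totallyReal) : SingularPlaceLifting 0 := by
  simpa using floor_zero h

/-- Given the floor, the rung is EXACTLY the open core. -/
theorem rung_iff_oneCell_of_floor (h : BLGGT2014_thm421_GL2_totallyReal) :
    PartialWeightOneLiftingTR ↔ OneSingularPlaceCell :=
  ⟨oneCell_of_rung, rung_of_cells (floor_zero h)⟩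

/-! ## 4. On-path (F4): the summit implies every rung -/

/-- **ON-PATH**: `Langlands → LiftingOn P` for EVERY `P`: clause (B) of the summit at any reciprocity datum (one
exists by the `Nonempty` conjunct) applies to every `ρ` of the sector — the local clauses are stated against the
PINNED Fontaine datum `fontainePstAdicCompletion v p hv = Rec.pst p v hv` (`rfl`); off `Z` crystalline ⇒ de Rham
(`IsCrystallineFramed.isDeRhamFramed`), on `Z` de Rham is the first conjunct of the singular clause; so the sector
gives `IsGeometricFramed Rec ρ`, and `Corresponds Rec ι π ρ` contains a.e. Satake–Frobenius compatibility. -/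
theorem liftingOn_of_langlands (P : ℕ → Prop) (hL : _root_.Langlands) : LiftingOn P := by
  intro F _ _ _hF p _ _hp _hdisc hcpt ι ρ Z _hcard _hZp _hw hirr hunr _hodd hreg hsing _hpd _htw _hmod
  obtain ⟨⟨Rec⟩, hall⟩ := hL F
  have hB : GaloisToAutomorphic 2 Rec hcpt := (hall Rec 2 two_pos hcpt).2
  have hdR : ∀ (v : HeightOneSpectrum (𝓞 F)) (hv : ((p : ℕ) : 𝓞 F) ∈ v.asIdeal),
      (Rec.pst p v hv).IsDeRhamFramed (ρ.toLocal v) := by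
    intro v hv
    change (fontainePstAdicCompletion v p hv).IsDeRhamFramed (ρ.toLocal v)
    by_cases hvZ : v ∈ Z
    · exact (hsing v hv hvZ).1
    · exact (hreg v hv hvZ).1.isDeRhamFramed
  have hgeo : IsGeometricFramed Rec ρ := ⟨hunr, hdR⟩
  obtain ⟨π, hπL, hcorr⟩ := hB p ι ρ hirr hgeo
  refine ⟨π, hπL, ?_⟩
  filter_upwards [hcorr.1] with v hv
  exact hv

/-- `Langlands → E(s)` for every `s`. -/
theorem singularPlaceLifting_of_langlands (s : ℕ) (hL : _root_.Langlands) : SingularPlaceLifting s :=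
  liftingOn_of_langlands _ hL

/-- **F4 on-path lemma for the rung**: `Langlands → PartialWeightOneLiftingTR`. -/
@[aesop safe apply]
theorem PartialWeightOneLiftingTR_of_Langlands (hL : _root_.Langlands) : PartialWeightOneLiftingTR :=
  singularPlaceLifting_of_langlands 1 hL

/-- The open core is also a consequence of the summit. -/
theorem oneSingularPlaceCell_of_langlands (hL : _root_.Langlands) : OneSingularPlaceCell :=
  liftingOn_of_langlands _ hL

example : _root_.Langlands → PartialWeightOneLiftingTR := by intro h; aesop


/-! ## 5. The sector of clause (B) carried by the rung, the merge target, the complement -/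

/-- **The singular-signature sector of clause (B)** at `(F, hcpt, ℓ, ι, ρ)` for `n = 2`: exactly the rung's
hypotheses — `F` totally real, `ℓ ≥ 7` unramified in `F`, a set `Z` of at most one place above `ℓ` (some place above
`ℓ` outside it), `ρ` totally odd, regular crystalline off `Z`, singular-unramified on `Z`, potentially diagonalizable
above `ℓ`, (TW), residually PD-automorphic (a.e. unramifiedness and irreducibility come with clause (B) itself). -/
def InSingularSector (F : Type) [Field F] [NumberField F] (hcpt : isCompact_glFiniteIntegralLevel 2 F)
    (ℓ : ℕ) [Fact ℓ.Prime] (ι : PadicAlgCl ℓ ≃+* ℂ) (ρ : FramedGaloisRep F (PadicAlgCl ℓ) 2) : Prop :=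
  IsTotallyReal F ∧ 7 ≤ ℓ ∧ ¬ ((ℓ : ℤ) ∣ NumberField.discr F) ∧
    ∃ Z : Finset (HeightOneSpectrum (𝓞 F)),
      Z.card ≤ 1 ∧ (∀ v ∈ Z, ((ℓ : ℕ) : 𝓞 F) ∈ v.asIdeal) ∧
      (∃ w : HeightOneSpectrum (𝓞 F), ((ℓ : ℕ) : 𝓞 F) ∈ w.asIdeal ∧ w ∉ Z) ∧
      ρ.IsOdd ∧
      (∀ (v : HeightOneSpectrum (𝓞 F)) (hv : ((ℓ : ℕ) : 𝓞 F) ∈ v.asIdeal), v ∉ Z →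
        RegularCrystallineAt ℓ ρ v hv) ∧
      (∀ (v : HeightOneSpectrum (𝓞 F)) (hv : ((ℓ : ℕ) : 𝓞 F) ∈ v.asIdeal), v ∈ Z →
        SingularUnramifiedAt ℓ ρ v hv) ∧
      PotentiallyDiagonalizableAt ℓ ρ ∧ TaylorWilesHypothesis F ℓ ρ ∧ ResiduallyPDAutomorphic F ℓ hcpt ι ρ

/-- **Merge target**: clause (B) of E VERBATIM (cuspidal, `L`-algebraic, `Corresponds Rec ι π ρ` — a.e. Satake AND
local–global compatibility at every finite place) for EVERY reciprocity datum `Rec`, on the singular-signature sector. -/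
def SectorGaloisToAutomorphic : Prop :=
  ∀ (F : Type) [Field F] [NumberField F] (Rec : ReciprocityData F) (hcpt : isCompact_glFiniteIntegralLevel 2 F)
    (ℓ : ℕ) [Fact ℓ.Prime] (ι : PadicAlgCl ℓ ≃+* ℂ) (ρ : FramedGaloisRep F (PadicAlgCl ℓ) 2),
    ρ.toGaloisRep.IsIrreducible → IsGeometricFramed Rec ρ → InSingularSector F hcpt ℓ ι ρ →
      ∃ π : CuspidalAutomorphicRepData 2 F hcpt, π.1.IsLAlgebraic ∧ Corresponds Rec ι π.1 ρ

/-- **The off-sector complement**: E (`ReciprocityUpToIrreducibility`) with clause (A′) entire, clause (B) entire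
for `n ≠ 2`, and clause (B) for `n = 2` restricted to `ρ` NOT in the singular-signature sector. -/
def OffSectorReciprocity : Prop :=
  ∀ (F : Type) [Field F] [NumberField F], ∃ Rec : ReciprocityData F,
    (∀ n : ℕ, 0 < n → ∀ hcpt : isCompact_glFiniteIntegralLevel n F,
      ∀ π : CuspidalAutomorphicRepData n F hcpt, π.1.IsLAlgebraic →
        ∀ (ℓ : ℕ) [Fact ℓ.Prime] (ι : PadicAlgCl ℓ ≃+* ℂ),
          ∃ ρ : FramedGaloisRep F (PadicAlgCl ℓ) n, IsGeometricFramed Rec ρ ∧ Corresponds Rec ι π.1 ρ) ∧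
    (∀ n : ℕ, 0 < n → n ≠ 2 → ∀ hcpt : isCompact_glFiniteIntegralLevel n F, GaloisToAutomorphic n Rec hcpt) ∧
    (∀ (hcpt : isCompact_glFiniteIntegralLevel 2 F) (ℓ : ℕ) [Fact ℓ.Prime] (ι : PadicAlgCl ℓ ≃+* ℂ)
      (ρ : FramedGaloisRep F (PadicAlgCl ℓ) 2),
      ρ.toGaloisRep.IsIrreducible → IsGeometricFramed Rec ρ → ¬ InSingularSector F hcpt ℓ ι ρ →
        ∃ π : CuspidalAutomorphicRepData 2 F hcpt, π.1.IsLAlgebraic ∧ Corresponds Rec ι π.1 ρ)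

/-! ## 6. The four registered stubs -/

/-- The floor: BLGGT Thm. 4.2.1 (`n = 2`, `F` totally real), a theorem in print held as a named fact (floor debt).
[cite: BarnetlambEtAl2014, Thm. 4.2.1] -/
theorem stub_floorFact : BLGGT2014_thm421_GL2_totallyReal := by
  sorry

/-- **THE OPEN CORE / cap-lifting input**: the single-singular-place cell — PARTIAL WEIGHT ONE automorphy lifting
for `GL₂` over totally real fields (one place above `p` of Hodge–Tate type `{0,0}`, unramified and residually
`p`-distinguished there; regular crystalline at the other places above `p`).  OPEN in characteristic zero (Stubley
2023 §7.3; Gee–Kassaei 2013 §1): neither overconvergent gluing (parallel weight one only) nor Hida / higher-Hida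
classicality (weights `≤ -1` or `≥ 3` at the varying place) nor small-slope partial classicality (slope `< k - 1`)
reaches weight `1` at one place. -/
theorem stub_singularCell : OneSingularPlaceCell := by
  sorry

/-- Sector merge: from a.e.-Satake automorphy on the singular-signature sector (the rung) to clause (B) of E verbatim
on `InSingularSector`, for every `Rec` (cuspidality is part of the rung's conclusion; local–global compatibility at
every finite place, the `v ∣ ℓ` clause against the pinned Fontaine datum, is the content). -/
theorem stub_sectorMerge : PartialWeightOneLiftingTR → SectorGaloisToAutomorphic := by
  sorry

/-- The honest complement: E off the singular-signature sector. -/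
theorem stub_offSector : OffSectorReciprocity := by
  sorry

/-! ## 7. Composition (no sorry below this line) -/

/-- The rung from the stubs that carry it (floor fact + single-singular-place cell), via the PROVED `rung_of_cells`. -/
theorem rung_of_floorFact_of_singularCell (hfloor : BLGGT2014_thm421_GL2_totallyReal)
    (hcell : OneSingularPlaceCell) : PartialWeightOneLiftingTR :=
  rung_of_cells (floor_zero hfloor) hcell

/-- **COMPOSITION — the crux BY NAME from the four stub statements.**  `Rec`, clause (A′), clause (B) for `n ≠ 2`
and clause (B) off the sector come from the off-sector statement; for `n = 2` clause (B) is a case split on the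
singular-signature sector, where the RUNG (assembled from the floor fact and the cell by `rung_of_cells`) feeds
the merge. -/
theorem ReciprocityUpToIrreducibility_of :
    BLGGT2014_thm421_GL2_totallyReal → OneSingularPlaceCell →
    (PartialWeightOneLiftingTR → SectorGaloisToAutomorphic) → OffSectorReciprocity →
    Summit.Langlands.Langlands.Theses.OrdinaryPrimeTransport.ReciprocityUpToIrreducibility := by
  intro hfloor hcell hmerge hoff F _ _
  obtain ⟨Rec, hA, hBne, hBoff⟩ := hoff F
  refine ⟨Rec, fun n hn hcpt => ⟨hA n hn hcpt, ?_⟩⟩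
  intro ℓ _ ι ρ hirr hgeo
  by_cases hn2 : n = 2
  · subst hn2
    by_cases hsec : InSingularSector F hcpt ℓ ι ρ
    · exact hmerge (rung_of_floorFact_of_singularCell hfloor hcell) F Rec hcpt ℓ ι ρ hirr hgeo hsec
    · exact hBoff hcpt ℓ ι ρ hirr hgeo hsec
  · exact hBne n hn hn2 hcpt ℓ ι ρ hirr hgeo

/-- **THE REGISTERED SKELETON THEOREM** — the item's decl from the four registered stubs (audit: proof-of-item
modulo the four sorries). -/
theorem ReciprocityUpToIrreducibility_proof :
    Summit.Langlands.Langlands.Theses.OrdinaryPrimeTransport.ReciprocityUpToIrreducibility :=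
  ReciprocityUpToIrreducibility_of stub_floorFact stub_singularCell stub_sectorMerge stub_offSector

/-- The rung from the registered stubs (it is load-bearing: `ReciprocityUpToIrreducibility_of` passes through it). -/
theorem rung_of_stubs : PartialWeightOneLiftingTR :=
  rung_of_floorFact_of_singularCell stub_floorFact stub_singularCell

/-! ## 8. The rung is a consequence of the top (sorry-free) -/

/-- `E → LiftingOn P` for every `P` (clause (B) of E for `n = 2`, for its own `Rec`). -/
theorem liftingOn_of_top (P : ℕ → Prop)
    (hE : Summit.Langlands.Langlands.Theses.OrdinaryPrimeTransport.ReciprocityUpToIrreducibility) :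
    LiftingOn P := by
  intro F _ _ _hF p _ _hp _hdisc hcpt ι ρ Z _hcard _hZp _hw hirr hunr _hodd hreg hsing _hpd _htw _hmod
  obtain ⟨Rec, hall⟩ := hE F
  have hB : GaloisToAutomorphic 2 Rec hcpt := (hall 2 two_pos hcpt).2
  have hdR : ∀ (v : HeightOneSpectrum (𝓞 F)) (hv : ((p : ℕ) : 𝓞 F) ∈ v.asIdeal),
      (Rec.pst p v hv).IsDeRhamFramed (ρ.toLocal v) := by
    intro v hv
    change (fontainePstAdicCompletion v p hv).IsDeRhamFramed (ρ.toLocal v)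
    by_cases hvZ : v ∈ Z
    · exact (hsing v hv hvZ).1
    · exact (hreg v hv hvZ).1.isDeRhamFramed
  obtain ⟨π, hπL, hcorr⟩ := hB p ι ρ hirr ⟨hunr, hdR⟩
  refine ⟨π, hπL, ?_⟩
  filter_upwards [hcorr.1] with v hv
  exact hv

/-- `E → rung`. -/
theorem PartialWeightOneLiftingTR_of_top
    (hE : Summit.Langlands.Langlands.Theses.OrdinaryPrimeTransport.ReciprocityUpToIrreducibility) :
    PartialWeightOneLiftingTR :=
  (liftingOn_of_top _ hE : SingularPlaceLifting 1)

/-- `E → open core`. -/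
theorem OneSingularPlaceCell_of_top
    (hE : Summit.Langlands.Langlands.Theses.OrdinaryPrimeTransport.ReciprocityUpToIrreducibility) :
    OneSingularPlaceCell :=
  liftingOn_of_top _ hE

end Summit.Langlands.Langlands.Cruxes.ReciprocityUpToIrreducibility.PartialWeightOneLiftingTR

end
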